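import Summits.AtomisticToContinuum.BoseEinsteinCondensation.Theorems.BECProbeMassFlowRecoilTransferOfMassFlow
import Literature.MathematicalPhysics.QuantumManyBody.TorusBoseFockLayer
import HarnessLib

/-!
# Crux `RecoilTransfer` (stmt-AtomisticToContinuum-12311) — STRATEGY CENSUS, typed part

Strategist seat `cstrat-stmt-AtomisticToContinuum-12311-s1` (planner, 2026-08-17). Companion of
`Cruxes/RecoilTransfer/STRATEGY-CENSUS.md`. This file is NOT a line: it registers no `stub_*`, it
overwrites nothing of the live skeleton `Lines/birth.lean` (v10, one open stub
`stub_massFlowZeroMomentum` = C′), and nothing here is proposed to `Theorems/`. It only TYPES the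
census attempts over the tree's vocabulary so that "no strategy short of the summit" is a statement
about checked signatures, not prose:

* `ZeroMomentumFloor`, `MassFlowZeroMomentum` (= the body of C′, `massFlowZeroMomentum_iff`);
* STRENGTHEN: `MonotoneMassFlow` (ε-free comparison in the mass; `massFlow_of_monotone` proved; the
  statement is one-loop FALSE for hard spheres — census §Strengthen) and `RecoilFidelity` (ground states
  of `H_κ` and `H_1` on `Q = 0` are `L²`-close uniformly in `N`);
* DECOMPOSITION "reward split": `rewardedEnergy` (`E₁ + μ(1 - A)`, a zero-mode REWARD of total strength
  `μ` for the tagged particle), `RecoilBudget` (an intensive recoil cost for some static near-minimiser —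
  infrared-bound strength), `RewardedTransfer` (PROVED here: pure variational algebra), `RewardRemoval`
  (floors under every large-but-`N`-independent reward persist at `μ = 0` — source removal, the residual
  crux), and the sorry-free glue `massFlow_of_rewardSplit` / `recoilTransfer_of_rewardSplit`;
* DECOMPOSITION "UV/IR split": `tailWeight`, `shellWeight`, `TailChebyshev` (provable from the tree's
  `tsum_normSq_waveVector_mul_momentumOccupation`), `LowModeNoPileUp` (the infrared core = complete BEC).

Everything elaborates; the only proofs are the two elementary ones. See the census for why none of the
open pieces is easier than C′.
-/

noncomputable section

open MeasureTheory Filter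
open scoped ENNReal NNReal

namespace Summit.AtomisticToContinuum.BoseEinsteinCondensation.Cruxes.RecoilTransfer.StrategyCensus

open Literature.MathematicalPhysics.QuantumManyBody
open Literature.MathematicalPhysics.QuantumManyBody.BoseGas
open Summit.AtomisticToContinuum.BoseEinsteinCondensation.Theses.BECProbeMassFlow
open Summit.AtomisticToContinuum.BoseEinsteinCondensation.Theorems

/-! ### The stub C′ with a named floor predicate -/

/-- **Zero-momentum floor** at mass ratio `κ`: some slack `δ > 0` such that every tagged trial state of
total momentum `0` within `δ` of the infimum of `H_κ` keeps the tagged particle in the constant mode with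
weight `≥ a`. [folklore] -/
def ZeroMomentumFloor (v : ℝ → ℝ≥0∞) (κ : ℝ) (N : ℕ) (L : ℝ) (a : ℝ) : Prop :=
  ∃ δ : ℝ≥0∞, 0 < δ ∧ ∀ Ψ : TaggedPeriodicTrialState N L, HasTotalMomentum 0 Ψ.ψ →
    taggedPeriodicEnergy v κ Ψ ≤ taggedPeriodicGroundStateEnergy v κ N L + δ →
      ENNReal.ofReal a ≤ taggedZeroModeOccupation N L Ψ.ψ

/-- A floor is antitone in the level. [folklore] -/
theorem ZeroMomentumFloor.mono {v : ℝ → ℝ≥0∞} {κ : ℝ} {N : ℕ} {L : ℝ} {a b : ℝ} (hab : b ≤ a)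
    (h : ZeroMomentumFloor v κ N L a) : ZeroMomentumFloor v κ N L b := by
  obtain ⟨δ, hδ, hfl⟩ := h
  exact ⟨δ, hδ, fun Ψ hQ hE => (ENNReal.ofReal_le_ofReal hab).trans (hfl Ψ hQ hE)⟩

/-- **C′ (`stub_massFlowZeroMomentum` of `Lines/birth.lean`) with the named floor.** [folklore] -/
def MassFlowZeroMomentum : Prop :=
  ∀ v : ℝ → ℝ≥0∞, IsRepulsiveFiniteRange v → ∀ ε : ℝ, 0 < ε →
    ∃ ρ₀ : ℝ, 0 < ρ₀ ∧ ∀ ρ : ℝ, 0 < ρ → ρ < ρ₀ → ∀ᶠ N : ℕ in Filter.atTop,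
      ∀ a : ℝ, ∀ κ₀ : ℝ, 0 < κ₀ → κ₀ ≤ 1 →
        (∀ κ : ℝ, 0 < κ → κ ≤ κ₀ → ZeroMomentumFloor v κ N (sideLength ρ (N + 1)) a) →
          ZeroMomentumFloor v 1 N (sideLength ρ (N + 1)) (a - ε)

/-- `MassFlowZeroMomentum` is VERBATIM the registered stub body (the hypothesis of the landed reduction
`recoilTransfer_of_massFlowZeroMomentum`, p161235). [folklore] -/
theorem massFlowZeroMomentum_iff :
    MassFlowZeroMomentum ↔
    (∀ v : ℝ → ℝ≥0∞, IsRepulsiveFiniteRange v → ∀ ε : ℝ, 0 < ε →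
      ∃ ρ₀ : ℝ, 0 < ρ₀ ∧ ∀ ρ : ℝ, 0 < ρ → ρ < ρ₀ → ∀ᶠ N : ℕ in Filter.atTop,
        ∀ a : ℝ, ∀ κ₀ : ℝ, 0 < κ₀ → κ₀ ≤ 1 →
          (∀ κ : ℝ, 0 < κ → κ ≤ κ₀ → ∃ δ : ℝ≥0∞, 0 < δ ∧
            ∀ Ψ : TaggedPeriodicTrialState N (sideLength ρ (N + 1)), HasTotalMomentum 0 Ψ.ψ →
              taggedPeriodicEnergy v κ Ψ ≤
                  taggedPeriodicGroundStateEnergy v κ N (sideLength ρ (N + 1)) + δ →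
                ENNReal.ofReal a ≤ taggedZeroModeOccupation N (sideLength ρ (N + 1)) Ψ.ψ) →
          ∃ δ' : ℝ≥0∞, 0 < δ' ∧
            ∀ Ψ : TaggedPeriodicTrialState N (sideLength ρ (N + 1)), HasTotalMomentum 0 Ψ.ψ →
              taggedPeriodicEnergy v 1 Ψ ≤
                  taggedPeriodicGroundStateEnergy v 1 N (sideLength ρ (N + 1)) + δ' →
                ENNReal.ofReal (a - ε) ≤ taggedZeroModeOccupation N (sideLength ρ (N + 1)) Ψ.ψ) :=
  Iff.rfl

/-- The census object feeds the crux through the landed reduction. [folklore] -/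
theorem recoilTransfer_of_massFlowZeroMomentum' (h : MassFlowZeroMomentum) : RecoilTransfer :=
  recoilTransfer_of_massFlowZeroMomentum (massFlowZeroMomentum_iff.1 h)

/-! ### STRENGTHEN (1): the ε-free comparison in the mass -/

/-- **S⁺₁ — monotone mass flow (NOT claimed; one-loop FALSE for hard spheres).** Floors on the
zero-momentum near-minimisers propagate UPWARD in `κ` with no loss, eventually in `N` at low density:
`Ā_N(κ) ≤ Ā_N(κ')` for `κ ≤ κ'`. Recorded because its rigidity (Hellmann–Feynman / concavity of
`κ ↦ E_κ`) is exactly what the ε-form lacks — and because the one-loop endpoint values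
`1 - Ā(0⁺) ≈ 0.886(b/a)²√(ρa³)` vs `1 - Ā(1) ≈ 1.505√(ρa³)` order it FALSE for `b/a < 1.30`.
[cite: GuentherEtAl2021, eq. (14); LSSY2005, App. A (Bogoliubov depletion)] -/
def MonotoneMassFlow : Prop :=
  ∀ v : ℝ → ℝ≥0∞, IsRepulsiveFiniteRange v →
    ∃ ρ₀ : ℝ, 0 < ρ₀ ∧ ∀ ρ : ℝ, 0 < ρ → ρ < ρ₀ → ∀ᶠ N : ℕ in Filter.atTop,
      ∀ a κ κ' : ℝ, 0 < κ → κ ≤ κ' → κ' ≤ 1 →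
        ZeroMomentumFloor v κ N (sideLength ρ (N + 1)) a →
          ZeroMomentumFloor v κ' N (sideLength ρ (N + 1)) a

/-- S⁺₁ would give C′ (with room: the hypothesis at `κ = κ₀` alone suffices). [folklore] -/
theorem massFlow_of_monotone (h : MonotoneMassFlow) : MassFlowZeroMomentum := by
  intro v hv ε hε
  obtain ⟨ρ₀, hρ₀, h⟩ := h v hv
  refine ⟨ρ₀, hρ₀, fun ρ hρ hρlt => ?_⟩
  filter_upwards [h ρ hρ hρlt] with N hN a κ₀ hκ₀ hκ₀1 hfloor
  exact (hN a κ₀ 1 hκ₀ hκ₀1 le_rfl (hfloor κ₀ hκ₀ le_rfl)).mono (by linarith)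

/-! ### STRENGTHEN (2): fidelity of the two ground-state classes -/

/-- **S⁺₂ — recoil fidelity (NOT claimed).** At low density, eventually in `N`: for every `κ₀` there is
`κ ≤ κ₀` and a slack `δ` such that every zero-momentum `δ`-near-minimiser of `H_κ` and every zero-momentum
`δ`-near-minimiser of `H_1` are `ε`-close in `L²(cell^{N+1})` up to a phase. Implies C′ through the
`2(N+1)√η` Lipschitz bound `condensateOccupation_le_add_of_sq_dist_le` (per particle: `2√η`). One loop:
`1 - F = Σ_k |α⁰_k - α¹_k|² = O(√(ρa³))`, infrared-finite with two powers to spare (recoil `k²` is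
irrelevant against `ck` on phonons) — the only structural advantage over C′; every rigorous fidelity bound
(Temple / Davis–Kahan: `1 - F ≤ (energy excess)/(gap)`) needs the `Q = 0` gap `≍ 2πc/L → 0`.
[cite: GuentherEtAl2021, eqs. (8), (14); LSSY2005, Ch. 5 §5.1 (gap mechanism)] -/
def RecoilFidelity : Prop :=
  ∀ v : ℝ → ℝ≥0∞, IsRepulsiveFiniteRange v → ∀ ε : ℝ, 0 < ε →
    ∃ ρ₀ : ℝ, 0 < ρ₀ ∧ ∀ ρ : ℝ, 0 < ρ → ρ < ρ₀ → ∀ᶠ N : ℕ in Filter.atTop,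
      ∀ κ₀ : ℝ, 0 < κ₀ → κ₀ ≤ 1 → ∃ κ : ℝ, 0 < κ ∧ κ ≤ κ₀ ∧ ∃ δ : ℝ≥0∞, 0 < δ ∧
        ∀ Ψ Φ : TaggedPeriodicTrialState N (sideLength ρ (N + 1)),
          HasTotalMomentum 0 Ψ.ψ → HasTotalMomentum 0 Φ.ψ →
          taggedPeriodicEnergy v κ Ψ ≤ taggedPeriodicGroundStateEnergy v κ N (sideLength ρ (N + 1)) + δ →
          taggedPeriodicEnergy v 1 Φ ≤ taggedPeriodicGroundStateEnergy v 1 N (sideLength ρ (N + 1)) + δ →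
            ∃ θ : ℝ, ∫ X in cellN (N + 1) (sideLength ρ (N + 1)),
              ‖Φ.ψ X - Complex.exp (θ * Complex.I) * Ψ.ψ X‖ ^ 2 ≤ ε

/-! ### DECOMPOSITION (1): the reward split -/

/-- **The rewarded equal-mass energy** `R_μ(Φ) = ⟨Φ, H_1 Φ⟩ + μ (1 - A(Φ))`: up to the constant `μ`,
the quadratic form of `H_1 - μ Π₀^{(0)}` with `Π₀^{(0)}` the projection of the TAGGED coordinate onto the
constant mode — a zero-mode reward of TOTAL strength `μ` (per particle `μ/(N+1)` after symmetrisation: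
an infinitesimal number-conserving source in the thermodynamic limit). [folklore] -/
def rewardedEnergy (v : ℝ → ℝ≥0∞) (μ : ℝ) {N : ℕ} {L : ℝ} (Φ : TaggedPeriodicTrialState N L) : ℝ≥0∞ :=
  taggedPeriodicEnergy v 1 Φ + ENNReal.ofReal μ * (1 - taggedZeroModeOccupation N L Φ.ψ)

/-- **Sub₁ — recoil budget (OPEN; infrared-bound strength).** At low density there is an intensive
constant `C = C(v, ρ)` such that, eventually in `N`, at every mass ratio `κ ∈ (0, 1]` and every slack,
SOME zero-momentum near-minimiser `Ψ` of `H_κ` has recoil cost `⟨Ψ, (H_1 - H_κ)Ψ⟩ = (1-κ)⟨P_bath²⟩_Ψ ≤ C`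
(and finite energy). For the pinned ground state `⟨P_bath²⟩ = ⟨F (H_imp - e₀)⁻² F⟩` with `F = Σⱼ∇v(yⱼ)`
the total force of the scatterer on the bath: a NEGATIVE-SECOND moment of the force spectral function,
finite at one loop (`Σ_k k²|α_k|² = O(ρ b²/R₀)`) only because phonons couple like `k^{3/2}` — i.e. through
`S(k) ≲ k/2c`, an infrared bound on the bath. [cite: GuentherEtAl2021, eqs. (8), (14)] -/
def RecoilBudget : Prop :=
  ∀ v : ℝ → ℝ≥0∞, IsRepulsiveFiniteRange v →
    ∃ ρ₀ : ℝ, 0 < ρ₀ ∧ ∀ ρ : ℝ, 0 < ρ → ρ < ρ₀ → ∃ C : ℝ, 0 ≤ C ∧ ∀ᶠ N : ℕ in Filter.atTop,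
      ∀ κ : ℝ, 0 < κ → κ ≤ 1 → ∀ δ : ℝ≥0∞, 0 < δ →
        ∃ Ψ : TaggedPeriodicTrialState N (sideLength ρ (N + 1)), HasTotalMomentum 0 Ψ.ψ ∧
          taggedPeriodicEnergy v κ Ψ ≤ taggedPeriodicGroundStateEnergy v κ N (sideLength ρ (N + 1)) + δ ∧
          taggedPeriodicEnergy v 1 Ψ ≤ taggedPeriodicEnergy v κ Ψ + ENNReal.ofReal C ∧
          taggedPeriodicEnergy v 1 Ψ ≠ ⊤

/-- **Sub₂ — rewarded transfer (PROVED below: variational algebra, fixed `(N, L)`).** If `Ψ` has tagged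
zero-mode weight `≥ a`, finite `H_1`-energy within `δ + C` of the `H_1`-infimum, then every `Φ` whose
rewarded energy is within `δ'` of that of `Ψ` has zero-mode weight `≥ a - (C + δ + δ')/μ`. [folklore] -/
def RewardedTransfer : Prop :=
  ∀ (N : ℕ) (L : ℝ) (v : ℝ → ℝ≥0∞) (μ C a : ℝ), 0 < μ → 0 ≤ C →
    ∀ δ δ' : ℝ≥0∞, δ ≠ ⊤ → δ' ≠ ⊤ →
    ∀ Ψ Φ : TaggedPeriodicTrialState N L,
      taggedPeriodicEnergy v 1 Ψ ≠ ⊤ →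
      ENNReal.ofReal a ≤ taggedZeroModeOccupation N L Ψ.ψ →
      taggedPeriodicEnergy v 1 Ψ ≤ taggedPeriodicGroundStateEnergy v 1 N L + δ + ENNReal.ofReal C →
      rewardedEnergy v μ Φ ≤ rewardedEnergy v μ Ψ + δ' →
        ENNReal.ofReal (a - (C + δ.toReal + δ'.toReal) / μ) ≤ taggedZeroModeOccupation N L Φ.ψ

/-- **Sub₃ — reward removal (OPEN; the residual crux).** At low density, eventually in `N`: if for every
`θ > 0` all zero-momentum near-minimisers of the rewarded energy `R_μ` keep tagged zero-mode weight
`≥ a - θ` for ALL SUFFICIENTLY LARGE but `N`-independent rewards `μ`, then the zero-momentum near-minimisers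
of `H_1` itself keep weight `≥ a - ε`. This is removal of a zero-mode source whose total strength is `O(1)`
(`≫` the gap `≍ 2πc/L`, `≪` the quasi-average sources `νN` of LSSY App. D): convexity in `μ` only brackets
the `μ = 0` weight between the one-sided derivatives of `μ ↦ inf R_μ`, exactly the open direction of the
catalogued barrier `SymmetryBreakingWithoutCondensate`. [cite: LSSY2005, App. D (D.17)–(D.19)] -/
def RewardRemoval : Prop :=
  ∀ v : ℝ → ℝ≥0∞, IsRepulsiveFiniteRange v → ∀ ε : ℝ, 0 < ε →
    ∃ ρ₀ : ℝ, 0 < ρ₀ ∧ ∀ ρ : ℝ, 0 < ρ → ρ < ρ₀ → ∀ᶠ N : ℕ in Filter.atTop, ∀ a : ℝ,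
      (∀ θ : ℝ, 0 < θ → ∃ μ₀ : ℝ, 0 < μ₀ ∧ ∀ μ : ℝ, μ₀ ≤ μ → ∃ δ' : ℝ≥0∞, 0 < δ' ∧
        ∀ Φ : TaggedPeriodicTrialState N (sideLength ρ (N + 1)), HasTotalMomentum 0 Φ.ψ →
          (∀ Ψ : TaggedPeriodicTrialState N (sideLength ρ (N + 1)), HasTotalMomentum 0 Ψ.ψ →
              rewardedEnergy v μ Φ ≤ rewardedEnergy v μ Ψ + δ') →
            ENNReal.ofReal (a - θ) ≤ taggedZeroModeOccupation N (sideLength ρ (N + 1)) Φ.ψ) →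
      ZeroMomentumFloor v 1 N (sideLength ρ (N + 1)) (a - ε)

/-- **Sub₂ holds** (pure `ℝ≥0∞`/real bookkeeping around the variational principle
`E_1 ≤ ⟨Φ, H_1 Φ⟩`). [folklore] -/
theorem rewardedTransfer : RewardedTransfer := by
  intro N L v μ C a hμ hC δ δ' hδ hδ' Ψ Φ hfin ha hE hR
  -- names
  set AΨ := taggedZeroModeOccupation N L Ψ.ψ with hAΨ_def
  set AΦ := taggedZeroModeOccupation N L Φ.ψ with hAΦ_def
  set EΨ := taggedPeriodicEnergy v 1 Ψ with hEΨ_def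
  set EΦ := taggedPeriodicEnergy v 1 Φ with hEΦ_def
  set G := taggedPeriodicGroundStateEnergy v 1 N L with hG_def
  have hAΨ1 : AΨ ≤ 1 := Ψ.taggedZeroModeOccupation_le_one
  have hAΦ1 : AΦ ≤ 1 := Φ.taggedZeroModeOccupation_le_one
  have hAΦtop : AΦ ≠ ⊤ := ne_top_of_le_ne_top ENNReal.one_ne_top hAΦ1
  have hAΨtop : AΨ ≠ ⊤ := ne_top_of_le_ne_top ENNReal.one_ne_top hAΨ1
  have hμtop : ENNReal.ofReal μ ≠ ⊤ := ENNReal.ofReal_ne_top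
  have h1Φ : (1 - AΦ) ≠ ⊤ := ne_top_of_le_ne_top ENNReal.one_ne_top tsub_le_self
  have h1Ψ : (1 - AΨ) ≠ ⊤ := ne_top_of_le_ne_top ENNReal.one_ne_top tsub_le_self
  have hμΦ : ENNReal.ofReal μ * (1 - AΦ) ≠ ⊤ := ENNReal.mul_ne_top hμtop h1Φ
  have hμΨ : ENNReal.ofReal μ * (1 - AΨ) ≠ ⊤ := ENNReal.mul_ne_top hμtop h1Ψ
  -- the case `a ≤ 0` is trivial
  by_cases ha0 : a ≤ 0
  · have : a - (C + δ.toReal + δ'.toReal) / μ ≤ 0 := by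
      have : 0 ≤ (C + δ.toReal + δ'.toReal) / μ := by positivity
      linarith
    rw [ENNReal.ofReal_of_nonpos this]
    exact bot_le
  push Not at ha0
  -- then `a ≤ 1` (the floor `ofReal a ≤ AΨ ≤ 1`)
  have ha1 : a ≤ 1 := by
    have h : ENNReal.ofReal a ≤ 1 := ha.trans hAΨ1
    have := (ENNReal.ofReal_le_iff_le_toReal ENNReal.one_ne_top).1 h
    simpa using this
  -- variational principle and cancellation of `EΦ`
  have hGΦ : G ≤ EΦ := taggedPeriodicGroundStateEnergy_le v 1 Φ
  have hR' : EΦ + ENNReal.ofReal μ * (1 - AΦ) ≤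
      EΦ + (δ + ENNReal.ofReal C + ENNReal.ofReal μ * (1 - AΨ) + δ') := by
    calc EΦ + ENNReal.ofReal μ * (1 - AΦ)
        ≤ EΨ + ENNReal.ofReal μ * (1 - AΨ) + δ' := hR
      _ ≤ (G + δ + ENNReal.ofReal C) + ENNReal.ofReal μ * (1 - AΨ) + δ' := by gcongr
      _ ≤ (EΦ + δ + ENNReal.ofReal C) + ENNReal.ofReal μ * (1 - AΨ) + δ' := by gcongr
      _ = EΦ + (δ + ENNReal.ofReal C + ENNReal.ofReal μ * (1 - AΨ) + δ') := by ring
  have hEΦtop : EΦ ≠ ⊤ := by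
    have h : EΦ ≤ EΨ + ENNReal.ofReal μ * (1 - AΨ) + δ' := le_trans le_self_add hR
    exact ne_top_of_le_ne_top (ENNReal.add_ne_top.2 ⟨ENNReal.add_ne_top.2 ⟨hfin, hμΨ⟩, hδ'⟩) h
  have hkey : ENNReal.ofReal μ * (1 - AΦ) ≤
      δ + ENNReal.ofReal C + ENNReal.ofReal μ * (1 - AΨ) + δ' :=
    (ENNReal.add_le_add_iff_left hEΦtop).1 hR'
  -- use the floor on `Ψ`: `1 - AΨ ≤ 1 - ofReal a`
  have hΨa : ENNReal.ofReal μ * (1 - AΨ) ≤ ENNReal.ofReal μ * (1 - ENNReal.ofReal a) :=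
    mul_le_mul_right (tsub_le_tsub_left ha 1) _
  have hkey' : ENNReal.ofReal μ * (1 - AΦ) ≤
      δ + ENNReal.ofReal C + ENNReal.ofReal μ * (1 - ENNReal.ofReal a) + δ' := by
    calc ENNReal.ofReal μ * (1 - AΦ) ≤ δ + ENNReal.ofReal C + ENNReal.ofReal μ * (1 - AΨ) + δ' := hkey
      _ ≤ δ + ENNReal.ofReal C + ENNReal.ofReal μ * (1 - ENNReal.ofReal a) + δ' := by gcongr
  -- pass to real numbers
  have h1a : (1 - ENNReal.ofReal a) = ENNReal.ofReal (1 - a) := by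
    rw [← ENNReal.ofReal_one, ← ENNReal.ofReal_sub _ ha0.le]
  have hμa_top : ENNReal.ofReal μ * (1 - ENNReal.ofReal a) ≠ ⊤ :=
    ENNReal.mul_ne_top hμtop (by rw [h1a]; exact ENNReal.ofReal_ne_top)
  have hRHS_top : δ + ENNReal.ofReal C + ENNReal.ofReal μ * (1 - ENNReal.ofReal a) + δ' ≠ ⊤ :=
    ENNReal.add_ne_top.2 ⟨ENNReal.add_ne_top.2 ⟨ENNReal.add_ne_top.2 ⟨hδ, ENNReal.ofReal_ne_top⟩,
      hμa_top⟩, hδ'⟩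
  have hreal := (ENNReal.toReal_le_toReal hμΦ hRHS_top).2 hkey'
  rw [ENNReal.toReal_add (ENNReal.add_ne_top.2 ⟨ENNReal.add_ne_top.2 ⟨hδ, ENNReal.ofReal_ne_top⟩,
      hμa_top⟩) hδ',
    ENNReal.toReal_add (ENNReal.add_ne_top.2 ⟨hδ, ENNReal.ofReal_ne_top⟩) hμa_top,
    ENNReal.toReal_add hδ ENNReal.ofReal_ne_top, ENNReal.toReal_mul, ENNReal.toReal_mul, h1a,
    ENNReal.toReal_ofReal hμ.le, ENNReal.toReal_ofReal hC, ENNReal.toReal_ofReal (by linarith),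
    ENNReal.toReal_sub_of_le hAΦ1 ENNReal.one_ne_top, ENNReal.toReal_one] at hreal
  -- `hreal : μ * (1 - AΦ.toReal) ≤ δ.toReal + C + μ * (1 - a) + δ'.toReal`
  have hx : a - (C + δ.toReal + δ'.toReal) / μ ≤ AΦ.toReal := by
    have h3 : (a - AΦ.toReal) * μ ≤ C + δ.toReal + δ'.toReal := by linear_combination hreal
    have h4 : a - AΦ.toReal ≤ (C + δ.toReal + δ'.toReal) / μ := (le_div_iff₀ hμ).2 h3
    linarith
  calc ENNReal.ofReal (a - (C + δ.toReal + δ'.toReal) / μ)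
      ≤ ENNReal.ofReal AΦ.toReal := ENNReal.ofReal_le_ofReal hx
    _ = AΦ := ENNReal.ofReal_toReal hAΦtop

/-- **The reward split glues to C′** (sorry-free): `Sub₁ → Sub₂ → Sub₃ → C′`. Only the floor at
`κ = κ₀` is used (the small-`κ` floors carry no further uniform information, cf. MassFlowAnalysis §2).
[folklore] -/
theorem massFlow_of_rewardSplit (hB : RecoilBudget) (hT : RewardedTransfer) (hRm : RewardRemoval) :
    MassFlowZeroMomentum := by
  intro v hv ε hε
  obtain ⟨ρ₁, hρ₁, h₁⟩ := hRm v hv ε hε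
  obtain ⟨ρ₂, hρ₂, h₂⟩ := hB v hv
  refine ⟨min ρ₁ ρ₂, lt_min hρ₁ hρ₂, fun ρ hρ hρlt => ?_⟩
  obtain ⟨C, hC, hBN⟩ := h₂ ρ hρ (hρlt.trans_le (min_le_right _ _))
  filter_upwards [h₁ ρ hρ (hρlt.trans_le (min_le_left _ _)), hBN] with N hRN hBN' a κ₀ hκ₀ hκ₀1 hfloor
  refine hRN a fun θ hθ => ?_
  -- reward threshold: `μ ≥ 3C/θ + 1`
  refine ⟨3 * C / θ + 1, by positivity, fun μ hμ => ?_⟩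
  have hμpos : 0 < μ := lt_of_lt_of_le (by positivity) hμ
  have hCμ : 3 * C ≤ θ * μ := by
    have h1 : 3 * C / θ ≤ μ := by linarith
    have := (div_le_iff₀ hθ).1 h1
    linarith
  obtain ⟨δ₀, hδ₀, hfl⟩ := hfloor κ₀ hκ₀ le_rfl
  set δ' : ℝ≥0∞ := ENNReal.ofReal (θ * μ / 3) with hδ'_def
  have hδ'pos : 0 < δ' := ENNReal.ofReal_pos.2 (by positivity)
  have hδ'top : δ' ≠ ⊤ := ENNReal.ofReal_ne_top
  set δb : ℝ≥0∞ := min δ₀ δ' with hδb_def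
  have hδbpos : 0 < δb := lt_min hδ₀ hδ'pos
  have hδbtop : δb ≠ ⊤ := ne_top_of_le_ne_top hδ'top (min_le_right _ _)
  obtain ⟨Ψ, hQΨ, hnear, hbud, hfinΨ⟩ := hBN' κ₀ hκ₀ hκ₀1 δb hδbpos
  refine ⟨δ', hδ'pos, fun Φ hQΦ hΦnear => ?_⟩
  -- the floor applies to `Ψ`
  have haΨ : ENNReal.ofReal a ≤ taggedZeroModeOccupation N (sideLength ρ (N + 1)) Ψ.ψ :=
    hfl Ψ hQΨ (hnear.trans (add_le_add le_rfl (min_le_left _ _)))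
  -- `Ψ` is within `δb + C` of the `κ = 1` infimum
  have hE1 : taggedPeriodicEnergy v 1 Ψ ≤
      taggedPeriodicGroundStateEnergy v 1 N (sideLength ρ (N + 1)) + δb + ENNReal.ofReal C := by
    calc taggedPeriodicEnergy v 1 Ψ ≤ taggedPeriodicEnergy v κ₀ Ψ + ENNReal.ofReal C := hbud
      _ ≤ (taggedPeriodicGroundStateEnergy v κ₀ N (sideLength ρ (N + 1)) + δb) + ENNReal.ofReal C := by
          gcongr
      _ ≤ (taggedPeriodicGroundStateEnergy v 1 N (sideLength ρ (N + 1)) + δb) + ENNReal.ofReal C := by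
          gcongr
          exact taggedPeriodicGroundStateEnergy_mono hκ₀1 v N _
  have key := hT N (sideLength ρ (N + 1)) v μ C a hμpos hC δb δ' hδbtop hδ'top Ψ Φ hfinΨ haΨ hE1
    (hΦnear Ψ hQΨ)
  refine le_trans (ENNReal.ofReal_le_ofReal ?_) key
  -- `(C + δb + δ')/μ ≤ θ`
  have h1 : δb.toReal ≤ θ * μ / 3 := by
    have := ENNReal.toReal_mono hδ'top (min_le_right δ₀ δ')
    rwa [hδ'_def, ENNReal.toReal_ofReal (by positivity)] at this
  have h2 : δ'.toReal = θ * μ / 3 := ENNReal.toReal_ofReal (by positivity)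
  have h3 : (C + δb.toReal + δ'.toReal) / μ ≤ θ := by
    rw [div_le_iff₀ hμpos]
    linarith
  linarith

/-- **The reward split concludes the crux BY NAME** through the landed reduction. [folklore] -/
theorem recoilTransfer_of_rewardSplit (hB : RecoilBudget) (hT : RewardedTransfer) (hRm : RewardRemoval) :
    RecoilTransfer :=
  recoilTransfer_of_massFlowZeroMomentum' (massFlow_of_rewardSplit hB hT hRm)

/-! ### DECOMPOSITION (2): the UV/IR split of the `κ = 1` occupation -/

/-- Weight of the one-body momentum distribution on the momenta `|k| ≥ P₀` (tail). [cite: LSSY2005, App. A (A.11)] -/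
def tailWeight (N : ℕ) (L P₀ : ℝ) (Ψ : Config N → ℂ) : ℝ≥0∞ :=
  ∑' k : Momentum, if P₀ ≤ ‖waveVector L k‖ then momentumOccupation N L k Ψ else 0

/-- Weight on the punctured infrared shell `0 < |k| < P₀`. [cite: LSSY2005, App. A (A.11)] -/
def shellWeight (N : ℕ) (L P₀ : ℝ) (Ψ : Config N → ℂ) : ℝ≥0∞ :=
  ∑' k : Momentum, if k ≠ 0 ∧ ‖waveVector L k‖ < P₀ then momentumOccupation N L k Ψ else 0

/-- **UV piece — Chebyshev on the kinetic energy (provable-now from the tree's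
`tsum_normSq_waveVector_mul_momentumOccupation`: `Σ_k |k|² n_k = ⟨Ψ, TΨ⟩ ≤ ⟨Ψ, HΨ⟩`).**
[cite: LSSY2005, App. A (A.10), (A.11)] -/
def TailChebyshev : Prop :=
  ∀ (N : ℕ) (L : ℝ), 0 < L → ∀ (v : ℝ → ℝ≥0∞) (P₀ : ℝ), 0 < P₀ → ∀ Ψ : PeriodicTrialState N L,
    ENNReal.ofReal (P₀ ^ 2) * tailWeight N L P₀ Ψ.ψ ≤ periodicEnergy v Ψ

/-- **IR piece — no infrared pile-up (OPEN; = complete condensation given the energy upper bound).** For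
every `ε > 0`, at low density there is a shell radius `P₀ = P₀(v, ρ, ε)` (of order `(ρa/ε)^{1/2} ≍ 1/(ξ√ε)`)
such that, eventually in `N`, near-minimisers carry at most `εN` particles on `0 < |k| < P₀`. With
`TailChebyshev` and `E₀ ≤ 4πρa(1 + o(1))N` (`LSSY2005_upperBound_periodic`) this is complete BEC on the
torus, hence `RecoilTransfer` by `recoilTransfer_of_completeCondensation` (p163242); conversely complete
BEC gives it trivially. Generalised (type II/III) condensation in the shell is exactly what energy methods
cannot exclude (`EnergyAsymptoticsWithoutCondensation`, `CasimirBoxGeneralizedCondensation`).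
[cite: LSSY2005, Ch. 5 §5.1; Fournais2020, Thm. 1.2] -/
def LowModeNoPileUp : Prop :=
  ∀ v : ℝ → ℝ≥0∞, IsRepulsiveFiniteRange v → ∀ ε : ℝ, 0 < ε →
    ∃ ρ₀ : ℝ, 0 < ρ₀ ∧ ∀ ρ : ℝ, 0 < ρ → ρ < ρ₀ → ∃ P₀ : ℝ, 0 < P₀ ∧ ∀ᶠ N : ℕ in Filter.atTop,
      ∃ δ : ℝ≥0∞, 0 < δ ∧ ∀ Ψ : PeriodicTrialState N (sideLength ρ N),
        periodicEnergy v Ψ ≤ periodicGroundStateEnergy v N (sideLength ρ N) + δ →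
          shellWeight N (sideLength ρ N) P₀ Ψ.ψ ≤ ENNReal.ofReal (ε * N)

end Summit.AtomisticToContinuum.BoseEinsteinCondensation.Cruxes.RecoilTransfer.StrategyCensus

end
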